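import Literature.Analysis.FluidPDE.NSBootstrapLeibniz
import Literature.Analysis.FluidPDE.EllipticSliceBootstrap
import Literature.Analysis.FluidPDE.HeatDivFormTopImprovementQuant
import HarnessLib

/-!
# The Serrin bootstrap: the level step

Analysis/FluidPDE proofs file (theorems only). The induction step `k → k + 1` of the
higher-regularity bootstrap for bounded distributional Navier–Stokes solutions
(Lemarié-Rieusset 2016, Thm. 13.1, Steps 2–3; Seregin–Šverák 2009, §2 p. 8; Serrin 1962), on the
normalised cylinders `C(L, ρ) = ]-L, 0[ × B(0, ρ)`, with all constants fixed before the solution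
(`level_step`): from level-`k` data bounded by `K` on `C(L, ρ)` and the base identities one
obtains level-`(k+1)` data bounded by `Φ(K)` on every strictly smaller cylinder sharing the top.

Proof (module docstrings of the imported files): the new representatives of `∂ᵢ∂^γA_{bc}` and
`∂ᵢ∂^γu_b` are produced in `L²` by the gradient estimate for the differentiated weak spin equation
(`HeatDivForm.heatDivForm_gradient_L2_top`, flux from `NSBootstrap.heat_identity_level`) and by
the sliced elliptic estimate for the differentiated very weak Poisson equation
(`RepDeriv.exists_L2_partial_of_poisson`, `NSBootstrap.poisson_identity_level`); three rounds
`2 → 3 → 6 → ∞` of the parabolic improvement (`HeatDivForm.heatDivForm_improvement_top_quant`,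
flux bounded by `NSBootstrap.eLpNorm_prodRep_cons_le`) interleaved with the elliptic slice step
(`RepDeriv.eLpNorm_partial_le_of_poisson_pair`, `RepDeriv.ae_enorm_partial_le_of_poisson_pair`)
make them essentially bounded.

## References

* P. G. Lemarié-Rieusset, *The Navier–Stokes Problem in the 21st Century* (2016), Thm. 13.1.
  [`LemarieRieusset2016`]
* G. Seregin, V. Šverák, Comm. PDE 34 (2009) = arXiv:0804.1803, §2 p. 8. [`SereginSverak2009`]
* J. Serrin, Arch. Rational Mech. Anal. 9 (1962) 187–195. [folklore]
-/

noncomputable section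

open MeasureTheory Set Function Filter Topology TopologicalSpace Metric
open scoped NNReal ENNReal RealInnerProductSpace Laplacian

namespace Literature.Analysis.FluidPDE

namespace NSBootstrap

open RepDeriv

variable {u : ℝ → EuclideanSpace ℝ (Fin 3) → EuclideanSpace ℝ (Fin 3)}
  {G : ℝ → EuclideanSpace ℝ (Fin 3) → EuclideanSpace ℝ (Fin 3) →L[ℝ] EuclideanSpace ℝ (Fin 3)}
  {U : List (Fin 3) → Fin 3 → ℝ × EuclideanSpace ℝ (Fin 3) → ℝ}
  {A : List (Fin 3) → Fin 3 → Fin 3 → ℝ × EuclideanSpace ℝ (Fin 3) → ℝ}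

/-! ### Elementary facts about the cylinders -/

/-- The cylinders are measurable. [folklore] -/
theorem measurableSet_cyl (L ρ : ℝ) : MeasurableSet (cyl L ρ) :=
  (isOpen_Ioo.prod isOpen_ball).measurableSet

/-- The cylinders have finite measure. [folklore] -/
theorem volume_cyl_lt_top (L ρ : ℝ) : volume (cyl L ρ) < ⊤ := by
  rw [cyl, Measure.volume_eq_prod, Measure.prod_prod]
  exact ENNReal.mul_lt_top (by simp [Real.volume_Ioo]) measure_ball_lt_top

/-- The restricted measure is finite. [folklore] -/
theorem isFiniteMeasure_restrict_cyl (L ρ : ℝ) :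
    IsFiniteMeasure ((volume : Measure (ℝ × EuclideanSpace ℝ (Fin 3))).restrict (cyl L ρ)) :=
  isFiniteMeasure_restrict.2 (volume_cyl_lt_top L ρ).ne

/-- From `volume`-a.e. with membership to a.e. for the restricted measure. [folklore] -/
theorem ae_restrict_cyl_iff {L ρ : ℝ} {P : ℝ × EuclideanSpace ℝ (Fin 3) → Prop} :
    (∀ᵐ q ∂(volume.restrict (cyl L ρ)), P q) ↔
      ∀ᵐ q ∂(volume : Measure (ℝ × EuclideanSpace ℝ (Fin 3))), q ∈ cyl L ρ → P q :=
  ae_restrict_iff' (measurableSet_cyl L ρ)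

/-! ### Consequences of level data -/

section Facts

variable {L ρ : ℝ} {k : ℕ} {K : ℝ≥0}

/-- The velocity components agree a.e. with their order-zero representatives. [folklore] -/
theorem LevelData.ae_eq_U (h : LevelData u G L ρ k K U A) (l : Fin 3) :
    ∀ᵐ q ∂(volume : Measure (ℝ × EuclideanSpace ℝ (Fin 3))), q ∈ cyl L ρ → u q.1 q.2 l = U [] l q := by
  have hU := (h [] (by simp) l l).1
  simp only [List.map_nil] at hU
  exact (isRepDeriv_nil hU.1).ae_eq hU

/-- The spin entries agree a.e. with their order-zero representatives. [folklore] -/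
theorem LevelData.ae_eq_A (h : LevelData u G L ρ k K U A) (b c : Fin 3) :
    ∀ᵐ q ∂(volume : Measure (ℝ × EuclideanSpace ℝ (Fin 3))), q ∈ cyl L ρ → spinEntry G b c q = A [] b c q := by
  have hA := (h [] (by simp) b c).2.1
  simp only [List.map_nil] at hA
  exact (isRepDeriv_nil hA.1).ae_eq hA

/-- The velocity components are essentially bounded by `K`. [folklore] -/
theorem LevelData.ae_abs_u_le (h : LevelData u G L ρ k K U A) (l : Fin 3) :
    ∀ᵐ q ∂(volume : Measure (ℝ × EuclideanSpace ℝ (Fin 3))), q ∈ cyl L ρ → |u q.1 q.2 l| ≤ K := by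
  have hb := ae_restrict_cyl_iff.1 (h [] (by simp) l l).2.2.1
  filter_upwards [h.ae_eq_U l, hb] with q hq hq' hqQ
  rw [hq hqQ]; exact hq' hqQ

/-- The spin entries are essentially bounded by `K`. [folklore] -/
theorem LevelData.ae_abs_spinEntry_le (h : LevelData u G L ρ k K U A) (b c : Fin 3) :
    ∀ᵐ q ∂(volume : Measure (ℝ × EuclideanSpace ℝ (Fin 3))), q ∈ cyl L ρ → |spinEntry G b c q| ≤ K := by
  have hb := ae_restrict_cyl_iff.1 (h [] (by simp) b c).2.2.2
  filter_upwards [h.ae_eq_A b c, hb] with q hq hq' hqQ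
  rw [hq hqQ]; exact hq' hqQ

/-- The representatives, volume-a.e. bounded with membership. [folklore] -/
theorem LevelData.ae_abs_U_le (h : LevelData u G L ρ k K U A) {α : List (Fin 3)} (hα : α.length ≤ k) (l : Fin 3) :
    ∀ᵐ q ∂(volume : Measure (ℝ × EuclideanSpace ℝ (Fin 3))), q ∈ cyl L ρ → |U α l q| ≤ K :=
  ae_restrict_cyl_iff.1 (h α hα l l).2.2.1

/-- The representatives, volume-a.e. bounded with membership. [folklore] -/
theorem LevelData.ae_abs_A_le (h : LevelData u G L ρ k K U A) {α : List (Fin 3)} (hα : α.length ≤ k) (b c : Fin 3) :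
    ∀ᵐ q ∂(volume : Measure (ℝ × EuclideanSpace ℝ (Fin 3))), q ∈ cyl L ρ → |A α b c q| ≤ K :=
  ae_restrict_cyl_iff.1 (h α hα b c).2.2.2

/-- The products `u_l A_{bl'}` are locally integrable on the cylinder. [folklore] -/
theorem LevelData.hbase (h : LevelData u G L ρ k K U A) (l b l' : Fin 3) :
    LocallyIntegrableOn (fun q => u q.1 q.2 l * spinEntry G b l' q) (cyl L ρ) volume := by
  have hu := (h [] (by simp) l l).1.1
  have hA := (h [] (by simp) b l').2.1.1
  refine locallyIntegrableOn_of_bound (Q := cylOpens L ρ) (K := K * K)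
    (hu.aestronglyMeasurable.mul hA.aestronglyMeasurable) ?_
  filter_upwards [h.ae_abs_u_le l, h.ae_abs_spinEntry_le b l'] with q hq hq' hqQ
  rw [abs_mul]
  exact mul_le_mul (hq hqQ) (hq' hqQ) (abs_nonneg _) K.coe_nonneg

/-- The velocity is essentially bounded by `3K`. [folklore] -/
theorem LevelData.ae_norm_u_le (h : LevelData u G L ρ k K U A) :
    ∀ᵐ q ∂(volume.restrict (cyl L ρ)), ‖u q.1 q.2‖ ≤ 3 * K := by
  rw [ae_restrict_cyl_iff]
  filter_upwards [h.ae_abs_u_le 0, h.ae_abs_u_le 1, h.ae_abs_u_le 2] with q h0 h1 h2 hqQ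
  have e : u q.1 q.2 = WithLp.toLp 2 (fun c => u q.1 q.2 c) := (WithLp.toLp_ofLp 2 (u q.1 q.2)).symm
  calc ‖u q.1 q.2‖ = ‖(WithLp.toLp 2 (fun c => u q.1 q.2 c) : EuclideanSpace ℝ (Fin 3))‖ := by rw [← e]
    _ ≤ ∑ c, |u q.1 q.2 c| := norm_toLp_le_sum_abs _
    _ ≤ 3 * K := by
        rw [Fin.sum_univ_three]
        linarith [h0 hqQ, h1 hqQ, h2 hqQ]

/-- The velocity is a.e. strongly measurable on the cylinder. [folklore] -/
theorem LevelData.aestronglyMeasurable_u (h : LevelData u G L ρ k K U A) :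
    AEStronglyMeasurable (uncurry u) (volume.restrict (cyl L ρ)) := by
  have hc : ∀ c, AEStronglyMeasurable (fun q : ℝ × EuclideanSpace ℝ (Fin 3) => u q.1 q.2 c) (volume.restrict (cyl L ρ)) :=
    fun c => (h [] (by simp) c c).1.1.aestronglyMeasurable
  have h1 : AEMeasurable (fun q : ℝ × EuclideanSpace ℝ (Fin 3) => fun c => u q.1 q.2 c) (volume.restrict (cyl L ρ)) :=
    aemeasurable_pi_lambda _ fun c => (hc c).aemeasurable
  have h2 : AEStronglyMeasurable (fun q : ℝ × EuclideanSpace ℝ (Fin 3) =>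
      (WithLp.toLp 2 (fun c => u q.1 q.2 c) : EuclideanSpace ℝ (Fin 3))) (volume.restrict (cyl L ρ)) :=
    ((PiLp.continuous_toLp 2 (fun _ : Fin 3 => ℝ)).measurable.comp_aemeasurable h1).aestronglyMeasurable
  have e : (fun q : ℝ × EuclideanSpace ℝ (Fin 3) => (WithLp.toLp 2 (fun c => u q.1 q.2 c) : EuclideanSpace ℝ (Fin 3))) = uncurry u := by
    funext q; exact WithLp.toLp_ofLp 2 (u q.1 q.2)
  rw [e] at h2
  exact h2

/-- The spin entries are in `L^∞` on the cylinder. [folklore] -/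
theorem LevelData.memLp_top_spinEntry (h : LevelData u G L ρ k K U A) (b c : Fin 3) :
    MemLp (spinEntry G b c) ⊤ (volume.restrict (cyl L ρ)) :=
  memLp_top_of_bound (h [] (by simp) b c).2.1.1.aestronglyMeasurable K
    ((ae_restrict_cyl_iff.2 (h.ae_abs_spinEntry_le b c)).mono fun q hq => by rw [Real.norm_eq_abs]; exact hq)

/-- The spin fluxes are locally integrable on the cylinder. [folklore] -/
theorem LevelData.hflux (h : LevelData u G L ρ k K U A) (b c : Fin 3) :
    LocallyIntegrableOn (spinFlux u G b c) (cyl L ρ) volume := by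
  haveI := isFiniteMeasure_restrict_cyl L ρ
  have hm := memLp_spinFlux h.aestronglyMeasurable_u h.ae_norm_u_le (fun b c => h.memLp_top_spinEntry b c) b c
  exact IntegrableOn.locallyIntegrableOn (hm.integrable le_top)

/-- The representatives are a.e. strongly measurable on the cylinder. [folklore] -/
theorem LevelData.aesm_U (h : LevelData u G L ρ k K U A) {α : List (Fin 3)} (hα : α.length ≤ k) (l : Fin 3) :
    AEStronglyMeasurable (U α l) (volume.restrict (cyl L ρ)) :=
  (h α hα l l).1.locallyIntegrableOn.aestronglyMeasurable

/-- The representatives are a.e. strongly measurable on the cylinder. [folklore] -/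
theorem LevelData.aesm_A (h : LevelData u G L ρ k K U A) {α : List (Fin 3)} (hα : α.length ≤ k) (b c : Fin 3) :
    AEStronglyMeasurable (A α b c) (volume.restrict (cyl L ρ)) :=
  (h α hα b c).2.1.locallyIntegrableOn.aestronglyMeasurable

/-- Bounded representatives are in every `L^m` of the cylinder, with
`‖·‖_{L^m} ≤ |C(L,ρ)|^{1/m} K`. [folklore] -/
theorem eLpNorm_le_of_ae_abs_le_cyl {f : ℝ × EuclideanSpace ℝ (Fin 3) → ℝ} {m : ℝ≥0∞}
    (hb : ∀ᵐ q ∂(volume.restrict (cyl L ρ)), |f q| ≤ K) :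
    eLpNorm f m (volume.restrict (cyl L ρ)) ≤ (volume (cyl L ρ)) ^ m.toReal⁻¹ * K := by
  have := eLpNorm_le_of_abs_le (p := m) hb
  rwa [Measure.restrict_apply_univ] at this

/-- Bounded measurable functions are in every `L^m` of the cylinder. [folklore] -/
theorem memLp_of_ae_abs_le_cyl {f : ℝ × EuclideanSpace ℝ (Fin 3) → ℝ} {m : ℝ≥0∞}
    (hf : AEStronglyMeasurable f (volume.restrict (cyl L ρ)))
    (hb : ∀ᵐ q ∂(volume.restrict (cyl L ρ)), |f q| ≤ K) : MemLp f m (volume.restrict (cyl L ρ)) := by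
  haveI := isFiniteMeasure_restrict_cyl L ρ
  exact (memLp_top_of_bound hf K (hb.mono fun q hq => by rw [Real.norm_eq_abs]; exact hq)).mono_exponent le_top

end Facts

/-! ### Vector fields from frame components -/

section Vec

variable {X : Type*} [MeasurableSpace X]

/-- The field with components `a_i`, and its pairing with a gradient:
`⟪Σ_i a_i • e_i, ∇ψ⟫ = Σ_i a_i ∂_{e_i}ψ`. [folklore] -/
theorem inner_sumFrame_gradient (a : Fin 3 → ℝ) (φ : EuclideanSpace ℝ (Fin 3) → ℝ) (x : EuclideanSpace ℝ (Fin 3)) :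
    ⟪∑ i, a i • (frame i : EuclideanSpace ℝ (Fin 3)), gradient φ x⟫ = ∑ i, a i * fderiv ℝ φ x (frame i) := by
  rw [sum_inner]
  refine Finset.sum_congr rfl fun i _ => ?_
  rw [real_inner_smul_left, HeatDivForm.real_inner_gradient_right]

/-- `L^m` membership and norm of a field given by frame components (`1 ≤ m`). [folklore] -/
theorem memLp_sumFrame {μ : Measure X} {m : ℝ≥0∞} (hm : 1 ≤ m) {a : Fin 3 → X → ℝ}
    (ha : ∀ i, MemLp (a i) m μ) :
    MemLp (fun x => ∑ i, a i x • (frame i : EuclideanSpace ℝ (Fin 3))) m μ ∧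
      eLpNorm (fun x => ∑ i, a i x • (frame i : EuclideanSpace ℝ (Fin 3))) m μ ≤ ∑ i, eLpNorm (a i) m μ := by
  have hnorm : ∀ i x, ‖a i x • (frame i : EuclideanSpace ℝ (Fin 3))‖ ≤ ‖a i x‖ := fun i x => by
    rw [norm_smul, frame.orthonormal.1 i, mul_one]
  have h1 : ∀ i, MemLp (fun x => a i x • (frame i : EuclideanSpace ℝ (Fin 3))) m μ := fun i =>
    (ha i).of_le ((ha i).1.smul aestronglyMeasurable_const) (Eventually.of_forall (hnorm i))
  refine ⟨memLp_finsetSum _ fun i _ => h1 i, ?_⟩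
  have e : (fun x => ∑ i, a i x • (frame i : EuclideanSpace ℝ (Fin 3))) =
      ∑ i, fun x => a i x • (frame i : EuclideanSpace ℝ (Fin 3)) := by
    funext x; simp [Finset.sum_apply]
  rw [e]
  refine (eLpNorm_sum_le (fun i _ => (h1 i).1) hm).trans (Finset.sum_le_sum fun i _ => ?_)
  exact eLpNorm_mono (hnorm i)

end Vec

/-! ### The new representatives in `L²` -/

section NewReps

/-- Multi-indices of length `k + 1` are conses. [folklore] -/
theorem exists_eq_cons_of_length {k : ℕ} {δ : List (Fin 3)} (hδ : δ.length = k + 1) :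
    ∃ i γ, δ = i :: γ ∧ γ.length = k := by
  cases δ with
  | nil => simp at hδ
  | cons i γ => exact ⟨i, γ, rfl, by simpa using hδ⟩

set_option maxHeartbeats 3200000 in
/-- **The new representatives, in `L²`.** For `0 < L₁ < L`, `0 < ρ₁ < ρ` there is a finite
`Φ(K)` such that: given the base identities and level-`k` data bounded by `K` on `C(L, ρ)`, the
families extend to order `k + 1` on `C(L₁, ρ₁)` — the derivatives `∂ᵢ∂^γA_{bc}` represented in
`L²` by the gradient estimate for the differentiated weak spin equation
(`HeatDivForm.heatDivForm_gradient_L2_top`), the derivatives `∂ᵢ∂^γu_b` by the sliced elliptic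
estimate (`RepDeriv.exists_L2_partial_of_poisson`) — with
`Σ_l ‖U(i::γ) l‖_{L²} + Σ_{bc} ‖A(i::γ) b c‖_{L²} ≤ Φ(K)` for every `(i, γ)`. [folklore] -/
theorem exists_new_reps (k : ℕ) {L L₁ ρ ρ₁ : ℝ} (hL₁ : 0 < L₁) (hL : L₁ < L) (hρ₁ : 0 < ρ₁) (hρ : ρ₁ < ρ) :
    ∃ Φ : ℝ≥0 → ℝ≥0∞, (∀ K, Φ K ≠ ⊤) ∧
      ∀ (K : ℝ≥0) (u : ℝ → EuclideanSpace ℝ (Fin 3) → EuclideanSpace ℝ (Fin 3))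
        (G : ℝ → EuclideanSpace ℝ (Fin 3) → EuclideanSpace ℝ (Fin 3) →L[ℝ] EuclideanSpace ℝ (Fin 3))
        (U : List (Fin 3) → Fin 3 → ℝ × EuclideanSpace ℝ (Fin 3) → ℝ)
        (A : List (Fin 3) → Fin 3 → Fin 3 → ℝ × EuclideanSpace ℝ (Fin 3) → ℝ),
        BaseHeat u G L ρ → BasePoisson u G L ρ → LevelData u G L ρ k K U A →
        ∃ (U' : List (Fin 3) → Fin 3 → ℝ × EuclideanSpace ℝ (Fin 3) → ℝ)
          (A' : List (Fin 3) → Fin 3 → Fin 3 → ℝ × EuclideanSpace ℝ (Fin 3) → ℝ),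
          (∀ α : List (Fin 3), α.length ≤ k → U' α = U α ∧ A' α = A α) ∧
          (∀ α : List (Fin 3), α.length ≤ k + 1 → ∀ l,
            IsRepDeriv (cylOpens L₁ ρ₁) (fun q => u q.1 q.2 l) (α.map frame) (U' α l)) ∧
          (∀ α : List (Fin 3), α.length ≤ k + 1 → ∀ b c,
            IsRepDeriv (cylOpens L₁ ρ₁) (spinEntry G b c) (α.map frame) (A' α b c)) ∧
          ∀ δ : List (Fin 3), δ.length = k + 1 →
            (∀ l, MemLp (U' δ l) 2 (volume.restrict (cyl L₁ ρ₁))) ∧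
            (∀ b c, MemLp (A' δ b c) 2 (volume.restrict (cyl L₁ ρ₁))) ∧
            ∑ l, eLpNorm (U' δ l) 2 (volume.restrict (cyl L₁ ρ₁)) +
              ∑ b, ∑ c, eLpNorm (A' δ b c) 2 (volume.restrict (cyl L₁ ρ₁)) ≤ Φ K := by
  have hL0 : 0 < L := hL₁.trans hL
  have hρ0 : 0 < ρ := hρ₁.trans hρ
  -- the two constants
  obtain ⟨CF, hCF0, hCF⟩ := HeatDivForm.heatDivForm_gradient_L2_top (E := EuclideanSpace ℝ (Fin 3)) hL₁ hL hρ₁ hρ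
  obtain ⟨CD, hCD⟩ := exists_L2_partial_of_poisson (L := L) hρ₁ hρ
  -- volumes
  set V : ℝ≥0∞ := (volume (cyl L ρ)) ^ (2 : ℝ≥0∞).toReal⁻¹ with hV
  have hVt : V ≠ ⊤ := ENNReal.rpow_ne_top_of_nonneg (by positivity) (volume_cyl_lt_top L ρ).ne
  -- the bound
  set Φ : ℝ≥0 → ℝ≥0∞ := fun K =>
    3 * ((CD : ℝ≥0∞) * (V * K + 3 * (V * K))) +
      9 * (ENNReal.ofReal CF * (V * K + 3 * (V * (6 * 2 ^ k * K * K)))) with hΦ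
  have hΦt : ∀ K, Φ K ≠ ⊤ := by
    intro K
    simp only [hΦ]
    have h1 : V * K ≠ ⊤ := ENNReal.mul_ne_top hVt ENNReal.coe_ne_top
    have h2 : V * (6 * 2 ^ k * (K : ℝ≥0∞) * K) ≠ ⊤ :=
      ENNReal.mul_ne_top hVt (ENNReal.mul_ne_top (ENNReal.mul_ne_top (ENNReal.mul_ne_top (by norm_num)
        (ENNReal.pow_ne_top (by norm_num))) ENNReal.coe_ne_top) ENNReal.coe_ne_top)
    refine ENNReal.add_ne_top.2 ⟨ENNReal.mul_ne_top (by norm_num) (ENNReal.mul_ne_top ENNReal.coe_ne_top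
      (ENNReal.add_ne_top.2 ⟨h1, ENNReal.mul_ne_top (by norm_num) h1⟩)), ENNReal.mul_ne_top (by norm_num)
      (ENNReal.mul_ne_top ENNReal.ofReal_ne_top (ENNReal.add_ne_top.2 ⟨h1, ENNReal.mul_ne_top (by norm_num) h2⟩))⟩
  refine ⟨Φ, hΦt, ?_⟩
  intro K u G U A hheat hpoi hdata
  haveI := isFiniteMeasure_restrict_cyl L ρ
  haveI := isFiniteMeasure_restrict_cyl L₁ ρ₁
  haveI := isFiniteMeasure_restrict_cyl L ρ₁
  set μ₀ : Measure (ℝ × EuclideanSpace ℝ (Fin 3)) := volume.restrict (cyl L ρ) with hμ₀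
  set μ₁ : Measure (ℝ × EuclideanSpace ℝ (Fin 3)) := volume.restrict (cyl L₁ ρ₁) with hμ₁
  have hsub₁ : cyl L₁ ρ₁ ⊆ cyl L ρ := cyl_mono hL.le hρ.le
  have hsub₁' : cyl L₁ ρ₁ ⊆ cyl L ρ₁ := cyl_mono hL.le le_rfl
  have hsubρ : cyl L ρ₁ ⊆ cyl L ρ := cyl_mono le_rfl hρ.le
  -- hypotheses of the Leibniz lemmas at order `k`
  have hrepU : ∀ α : List (Fin 3), α.length ≤ k → ∀ l,
      IsRepDeriv (cylOpens L ρ) (fun q => u q.1 q.2 l) (α.map frame) (U α l) := fun α hα l => (hdata α hα l l).1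
  have hrepA : ∀ α : List (Fin 3), α.length ≤ k → ∀ b c,
      IsRepDeriv (cylOpens L ρ) (spinEntry G b c) (α.map frame) (A α b c) := fun α hα b c => (hdata α hα b c).2.1
  have hbdU : ∀ α : List (Fin 3), α.length + 1 ≤ k → ∀ l,
      ∀ᵐ q ∂(volume : Measure (ℝ × EuclideanSpace ℝ (Fin 3))), q ∈ cyl L ρ → |U α l q| ≤ K :=
    fun α hα l => hdata.ae_abs_U_le (Nat.le_of_succ_le hα) l
  have hbdA : ∀ α : List (Fin 3), α.length + 1 ≤ k → ∀ b c,
      ∀ᵐ q ∂(volume : Measure (ℝ × EuclideanSpace ℝ (Fin 3))), q ∈ cyl L ρ → |A α b c q| ≤ K :=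
    fun α hα b c => hdata.ae_abs_A_le (Nat.le_of_succ_le hα) b c
  -- bounds of the level-`k` fluxes
  have hflux_bd : ∀ {γ : List (Fin 3)}, γ.length ≤ k → ∀ b c i,
      ∀ᵐ q ∂μ₀, |fluxRep U A γ b c i q| ≤ ((6 * 2 ^ k * K * K : ℝ≥0) : ℝ) := by
    intro γ hγ b c i
    have hP : ∀ l b' l', ∀ᵐ q ∂μ₀, |prodRep U A γ l b' l' q| ≤ 2 ^ γ.length * (K : ℝ) ^ 2 := fun l b' l' =>
      ae_abs_prodRep_le (fun α hα l => (hdata α hα l l).2.2.1) (fun α hα b c => (hdata α hα b c).2.2.2) hγ l b' l'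
    have hall : ∀ᵐ q ∂μ₀, ∀ l b' l', |prodRep U A γ l b' l' q| ≤ 2 ^ γ.length * (K : ℝ) ^ 2 :=
      ae_all_iff.2 fun l => ae_all_iff.2 fun b' => ae_all_iff.2 fun l' => hP l b' l'
    filter_upwards [hall] with q hq
    have hin : ∀ j j' : Fin 3, |⟪(frame j : EuclideanSpace ℝ (Fin 3)), frame j'⟫| ≤ 1 := fun j j' => by
      rw [orthonormal_iff_ite.1 frame.orthonormal]; split_ifs <;> simp
    have hpow : (2 : ℝ) ^ γ.length ≤ 2 ^ k := pow_le_pow_right₀ (by norm_num) hγ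
    have hs : ∀ b', |∑ l, prodRep U A γ l b' l q| ≤ 3 * (2 ^ k * (K : ℝ) ^ 2) := fun b' => by
      refine (Finset.abs_sum_le_sum_abs _ _).trans ?_
      calc ∑ l, |prodRep U A γ l b' l q| ≤ ∑ _l : Fin 3, 2 ^ k * (K : ℝ) ^ 2 :=
            Finset.sum_le_sum fun l _ => (hq l b' l).trans (mul_le_mul_of_nonneg_right hpow (sq_nonneg _))
        _ = 3 * (2 ^ k * (K : ℝ) ^ 2) := by
            rw [Finset.sum_const, Finset.card_univ, Fintype.card_fin]; ring
    rw [fluxRep]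
    calc |-(⟪(frame c : EuclideanSpace ℝ (Fin 3)), frame i⟫ * ∑ l, prodRep U A γ l b l q) +
          ⟪(frame b : EuclideanSpace ℝ (Fin 3)), frame i⟫ * ∑ l, prodRep U A γ l c l q|
        ≤ |⟪(frame c : EuclideanSpace ℝ (Fin 3)), frame i⟫ * ∑ l, prodRep U A γ l b l q| +
          |⟪(frame b : EuclideanSpace ℝ (Fin 3)), frame i⟫ * ∑ l, prodRep U A γ l c l q| := by
          rw [← abs_neg (⟪(frame c : EuclideanSpace ℝ (Fin 3)), frame i⟫ * _)]; exact abs_add_le _ _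
      _ ≤ 1 * (3 * (2 ^ k * (K : ℝ) ^ 2)) + 1 * (3 * (2 ^ k * (K : ℝ) ^ 2)) := by
          rw [abs_mul, abs_mul]
          exact add_le_add (mul_le_mul (hin c i) (hs b) (abs_nonneg _) zero_le_one)
            (mul_le_mul (hin b i) (hs c) (abs_nonneg _) zero_le_one)
      _ = ((6 * 2 ^ k * K * K : ℝ≥0) : ℝ) := by push_cast; ring
  have hflux_meas : ∀ {γ : List (Fin 3)}, γ.length ≤ k → ∀ b c i, AEStronglyMeasurable (fluxRep U A γ b c i) μ₀ :=
    fun hγ b c i => aestronglyMeasurable_fluxRep (fun α hα l => hdata.aesm_U hα l) (fun α hα b c => hdata.aesm_A hα b c) hγ b c i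
  -- the level-`k` representatives in `L²` with norms
  have hUm : ∀ {γ : List (Fin 3)}, γ.length ≤ k → ∀ l, MemLp (U γ l) 2 μ₀ ∧ eLpNorm (U γ l) 2 μ₀ ≤ V * K :=
    fun hγ l => ⟨memLp_of_ae_abs_le_cyl (hdata.aesm_U hγ l) (hdata _ hγ l l).2.2.1,
      eLpNorm_le_of_ae_abs_le_cyl (hdata _ hγ l l).2.2.1⟩
  have hAm : ∀ {γ : List (Fin 3)}, γ.length ≤ k → ∀ b c, MemLp (A γ b c) 2 μ₀ ∧ eLpNorm (A γ b c) 2 μ₀ ≤ V * K :=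
    fun hγ b c => ⟨memLp_of_ae_abs_le_cyl (hdata.aesm_A hγ b c) (hdata _ hγ b c).2.2.2,
      eLpNorm_le_of_ae_abs_le_cyl (hdata _ hγ b c).2.2.2⟩
  have hFm : ∀ {γ : List (Fin 3)}, γ.length ≤ k → ∀ b c i, MemLp (fluxRep U A γ b c i) 2 μ₀ ∧
      eLpNorm (fluxRep U A γ b c i) 2 μ₀ ≤ V * (6 * 2 ^ k * K * K : ℝ≥0) :=
    fun hγ b c i => ⟨memLp_of_ae_abs_le_cyl (hflux_meas hγ b c i) (hflux_bd hγ b c i),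
      eLpNorm_le_of_ae_abs_le_cyl (hflux_bd hγ b c i)⟩
  ---------------------------------------------------------------------------------------------
  -- (A) the new representatives of `∂ᵢ∂^γ A_{bc}`
  ---------------------------------------------------------------------------------------------
  have hA_ex : ∀ (i : Fin 3) (γ : List (Fin 3)) (b c : Fin 3), ∃ g : ℝ × EuclideanSpace ℝ (Fin 3) → ℝ,
      γ.length = k →
        MemLp g 2 μ₁ ∧ eLpNorm g 2 μ₁ ≤ ENNReal.ofReal CF * (V * K + 3 * (V * (6 * 2 ^ k * K * K : ℝ≥0))) ∧
        IsRepDeriv (cylOpens L₁ ρ₁) (spinEntry G b c) (frame i :: γ.map frame) g := by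
    intro i γ b c
    by_cases hγ : γ.length = k
    swap
    · exact ⟨0, fun h => absurd h hγ⟩
    have hγ' : γ.length ≤ k := hγ.le
    -- the flux field and the heat identity at level `γ`
    set gv : ℝ × EuclideanSpace ℝ (Fin 3) → EuclideanSpace ℝ (Fin 3) :=
      fun q => ∑ i', fluxRep U A γ b c i' q • (frame i' : EuclideanSpace ℝ (Fin 3)) with hgv
    obtain ⟨hgvm, hgvn⟩ := memLp_sumFrame (μ := μ₀) one_le_two fun i' => (hFm hγ' b c i').1
    have hw := (hAm hγ' b c).1
    have heq : ∀ ψ : ℝ → EuclideanSpace ℝ (Fin 3) → ℝ, IsSpaceTimeTestOn (cylOpens L ρ) ψ →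
        ∫ q : ℝ × EuclideanSpace ℝ (Fin 3), A γ b c q * (timeDeriv ψ q.1 q.2 + (Δ (ψ q.1)) q.2) =
          ∫ q : ℝ × EuclideanSpace ℝ (Fin 3), ⟪gv q, gradient (ψ q.1) q.2⟫ := by
      intro ψ hψ
      rw [heat_identity_level hheat hrepU hrepA hbdU hbdA hdata.hbase hdata.hflux hγ' b c hψ]
      have hint : ∀ i', Integrable (fun q : ℝ × EuclideanSpace ℝ (Fin 3) =>
          fluxRep U A γ b c i' q * fderiv ℝ (ψ q.1) q.2 (frame i')) volume := fun i' =>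
        (isRepDeriv_fluxRep (Q := cylOpens L ρ) hrepU hrepA hbdU hbdA hdata.hbase hγ' b c i').2.1
          |> isRepDeriv_nil |>.integrable_mul' (NSSpinHeat.isSpaceTimeTestOn_fderiv_apply hψ (frame i'))
      rw [← integral_finsetSum _ fun i' _ => hint i']
      refine integral_congr_ae (Eventually.of_forall fun q => ?_)
      dsimp only
      rw [hgv, inner_sumFrame_gradient]
    obtain ⟨g, hgm, hgn, hgid⟩ := hCF (A γ b c) gv hw hgvm heq (frame i)
    have hind : (cyl L₁ ρ₁).indicator g =ᵐ[μ₁] g := indicator_ae_eq_restrict (measurableSet_cyl L₁ ρ₁)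
    have hg'm : MemLp ((cyl L₁ ρ₁).indicator g) 2 μ₁ := hgm.ae_eq hind.symm
    refine ⟨(cyl L₁ ρ₁).indicator g, fun _ => ⟨hg'm, ?_, ?_⟩⟩
    · rw [eLpNorm_congr_ae hind]
      refine hgn.trans ?_
      have ha : eLpNorm (A γ b c) 2 μ₀ ≠ ⊤ := hw.eLpNorm_ne_top
      have hb : eLpNorm gv 2 μ₀ ≠ ⊤ := hgvm.eLpNorm_ne_top
      rw [frame.orthonormal.1 i, mul_one, ENNReal.ofReal_mul hCF0,
        ENNReal.ofReal_add ENNReal.toReal_nonneg ENNReal.toReal_nonneg, ENNReal.ofReal_toReal ha,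
        ENNReal.ofReal_toReal hb]
      refine mul_le_mul' le_rfl (add_le_add (hAm hγ' b c).2 (hgvn.trans ?_))
      calc ∑ i', eLpNorm (fluxRep U A γ b c i') 2 μ₀ ≤ ∑ _i' : Fin 3, V * (6 * 2 ^ k * K * K : ℝ≥0) :=
            Finset.sum_le_sum fun i' _ => (hFm hγ' b c i').2
        _ = 3 * (V * (6 * 2 ^ k * K * K : ℝ≥0)) := by
            rw [Finset.sum_const, Finset.card_univ, Fintype.card_fin]; ring
    · refine ((hrepA γ hγ' b c).mono (cylOpens_mono hL.le hρ.le)).cons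
        (IntegrableOn.locallyIntegrableOn (hg'm.integrable one_le_two)) fun Ξ hΞ => ?_
      rw [hgid Ξ hΞ, ← integral_indicator (measurableSet_cyl L₁ ρ₁)]
      congr 1
      refine integral_congr_ae (Eventually.of_forall fun q => ?_)
      by_cases hq : q ∈ cyl L₁ ρ₁
      · simp [indicator_of_mem hq]
      · simp [indicator_of_notMem hq]
  ---------------------------------------------------------------------------------------------
  -- (U) the new representatives of `∂ᵢ∂^γ u_b`
  ---------------------------------------------------------------------------------------------
  have hU_ex : ∀ (i : Fin 3) (γ : List (Fin 3)) (b : Fin 3), ∃ g : ℝ × EuclideanSpace ℝ (Fin 3) → ℝ,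
      γ.length = k →
        MemLp g 2 μ₁ ∧ eLpNorm g 2 μ₁ ≤ (CD : ℝ≥0∞) * (V * K + 3 * (V * K)) ∧
        IsRepDeriv (cylOpens L₁ ρ₁) (fun q => u q.1 q.2 b) (frame i :: γ.map frame) g := by
    intro i γ b
    by_cases hγ : γ.length = k
    swap
    · exact ⟨0, fun h => absurd h hγ⟩
    have hγ' : γ.length ≤ k := hγ.le
    have hid := fun ψ (hψ : IsSpaceTimeTestOn (cylOpens L ρ) ψ) => poisson_identity_level hpoi hrepU hrepA hγ' b hψ
    obtain ⟨g, hgm, hgn, hgrep⟩ := hCD (U γ b) (fun c => A γ b c) (hUm hγ' b).1 (fun c => (hAm hγ' b c).1) hid i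
    have hgm₁ : MemLp g 2 μ₁ := hgm.mono_measure (Measure.restrict_mono hsub₁' le_rfl)
    refine ⟨g, fun _ => ⟨hgm₁, ?_, ?_⟩⟩
    · refine (eLpNorm_mono_measure g (Measure.restrict_mono hsub₁' le_rfl)).trans (hgn.trans ?_)
      refine mul_le_mul' le_rfl (add_le_add (hUm hγ' b).2 ?_)
      calc ∑ c, eLpNorm (A γ b c) 2 μ₀ ≤ ∑ _c : Fin 3, V * K := Finset.sum_le_sum fun c _ => (hAm hγ' b c).2
        _ = 3 * (V * K) := by rw [Finset.sum_const, Finset.card_univ, Fintype.card_fin]; ring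
    · have hgrep₁ : IsRepDeriv (cylOpens L₁ ρ₁) (U γ b) [frame i] g :=
        hgrep.mono (cylOpens_mono hL.le le_rfl)
      refine ((hrepU γ hγ' b).mono (cylOpens_mono hL.le hρ.le)).cons hgrep₁.locallyIntegrableOn fun Ξ hΞ => ?_
      have h := hgrep₁.integral_eq hΞ
      simpa [derivs_singleton] using h
  ---------------------------------------------------------------------------------------------
  -- the extended families
  ---------------------------------------------------------------------------------------------
  choose gA hgA using hA_ex
  choose gU hgU using hU_ex
  set U' : List (Fin 3) → Fin 3 → ℝ × EuclideanSpace ℝ (Fin 3) → ℝ :=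
    fun α l => if α.length = k + 1 then gU (α.headD 0) α.tail l else U α l with hU'
  set A' : List (Fin 3) → Fin 3 → Fin 3 → ℝ × EuclideanSpace ℝ (Fin 3) → ℝ :=
    fun α b c => if α.length = k + 1 then gA (α.headD 0) α.tail b c else A α b c with hA'
  have hU'old : ∀ α : List (Fin 3), α.length ≤ k → U' α = U α := fun α hα => by
    funext l; simp [hU', show α.length ≠ k + 1 by omega]
  have hA'old : ∀ α : List (Fin 3), α.length ≤ k → A' α = A α := fun α hα => by
    funext b c; simp [hA', show α.length ≠ k + 1 by omega]
  have hU'new : ∀ (i : Fin 3) (γ : List (Fin 3)), γ.length = k → ∀ l, U' (i :: γ) l = gU i γ l := fun i γ hγ l => by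
    simp [hU', hγ]
  have hA'new : ∀ (i : Fin 3) (γ : List (Fin 3)), γ.length = k → ∀ b c, A' (i :: γ) b c = gA i γ b c := fun i γ hγ b c => by
    simp [hA', hγ]
  refine ⟨U', A', fun α hα => ⟨hU'old α hα, hA'old α hα⟩, ?_, ?_, ?_⟩
  · intro α hα l
    rcases Nat.lt_or_ge α.length (k + 1) with hlt | hge
    · rw [hU'old α (by omega)]
      exact (hrepU α (by omega) l).mono (cylOpens_mono hL.le hρ.le)
    · obtain ⟨i, γ, rfl, hγ⟩ := exists_eq_cons_of_length (k := k) (δ := α) (by omega)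
      rw [hU'new i γ hγ l, List.map_cons]
      exact (hgU i γ l hγ).2.2
  · intro α hα b c
    rcases Nat.lt_or_ge α.length (k + 1) with hlt | hge
    · rw [hA'old α (by omega)]
      exact (hrepA α (by omega) b c).mono (cylOpens_mono hL.le hρ.le)
    · obtain ⟨i, γ, rfl, hγ⟩ := exists_eq_cons_of_length (k := k) (δ := α) (by omega)
      rw [hA'new i γ hγ b c, List.map_cons]
      exact (hgA i γ b c hγ).2.2
  · intro δ hδ
    obtain ⟨i, γ, rfl, hγ⟩ := exists_eq_cons_of_length hδ
    refine ⟨fun l => ?_, fun b c => ?_, ?_⟩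
    · rw [hU'new i γ hγ l]; exact (hgU i γ l hγ).1
    · rw [hA'new i γ hγ b c]; exact (hgA i γ b c hγ).1
    · simp only [hU'new i γ hγ, hA'new i γ hγ, hΦ]
      refine add_le_add ?_ ?_
      · calc ∑ l, eLpNorm (gU i γ l) 2 μ₁ ≤ ∑ _l : Fin 3, (CD : ℝ≥0∞) * (V * K + 3 * (V * K)) :=
              Finset.sum_le_sum fun l _ => (hgU i γ l hγ).2.1
          _ = 3 * ((CD : ℝ≥0∞) * (V * K + 3 * (V * K))) := by
              rw [Finset.sum_const, Finset.card_univ, Fintype.card_fin]; ring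
      · calc ∑ b, ∑ c, eLpNorm (gA i γ b c) 2 μ₁
            ≤ ∑ _b : Fin 3, ∑ _c : Fin 3, ENNReal.ofReal CF * (V * K + 3 * (V * (6 * 2 ^ k * K * K : ℝ≥0))) :=
              Finset.sum_le_sum fun b _ => Finset.sum_le_sum fun c _ => (hgA i γ b c hγ).2.1
          _ = 9 * (ENNReal.ofReal CF * (V * K + 3 * (V * (6 * 2 ^ k * K * K : ℝ≥0)))) := by
              simp only [Finset.sum_const, Finset.card_univ, Fintype.card_fin, nsmul_eq_mul]
              push_cast; ring

end NewReps


/-! ### One round of the improvement for a fixed new multi-index -/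

section Round

/-- The `L^m`-size of the new representatives at the multi-index `δ` on the measure `μ`. [folklore] -/
theorem sizeDef (U : List (Fin 3) → Fin 3 → ℝ × EuclideanSpace ℝ (Fin 3) → ℝ)
    (A : List (Fin 3) → Fin 3 → Fin 3 → ℝ × EuclideanSpace ℝ (Fin 3) → ℝ) (δ : List (Fin 3)) (m : ℝ≥0∞)
    (μ : Measure (ℝ × EuclideanSpace ℝ (Fin 3))) :
    (∑ l, eLpNorm (U δ l) m μ + ∑ b, ∑ c, eLpNorm (A δ b c) m μ) =
      ∑ l, eLpNorm (U δ l) m μ + ∑ b, ∑ c, eLpNorm (A δ b c) m μ := rfl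

set_option maxHeartbeats 6400000 in
/-- **One round `m → m'` of the improvement for the new representatives at `δ = i :: γ`**, with
the constants fixed before the solution. On `C(La, ρa)` let level-`k` data bounded by `K` be
given together with representatives of order `k + 1`, those at `δ` in `L^m`, and the base
identities. Then on `C(Lb, ρc)` (`Lb < La`, `ρc < ρb < ρa`) the representatives at `δ` are in
`L^{m'}` (`m' ≤ 6` finite, or `m' = ∞`), with `Σ ‖·‖_{L^{m'}} ≤ Ψ(K, Σ ‖·‖_{L^m})`, `Ψ` monotone
in its second argument: the parabolic improvement for `A δ b c`
(`HeatDivForm.heatDivForm_improvement_top_quant`, flux bounded by `eLpNorm_prodRep_cons_le`) and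
the elliptic slice step for `U δ b` (`RepDeriv.eLpNorm_partial_le_of_poisson_pair`,
`RepDeriv.ae_enorm_partial_le_of_poisson_pair`). [folklore] -/
theorem round (k : ℕ) {m m' : ℝ≥0∞} (h1m : 1 < m) (h2m : 2 ≤ m) (hmm' : m ≤ m')
    (hexp : m⁻¹ < m'⁻¹ + 5⁻¹) (hm' : m' ≤ 6 ∨ m' = ⊤)
    {La Lb ρa ρb ρc : ℝ} (hLb : 0 < Lb) (hLab : Lb < La) (hρc : 0 < ρc) (hρbc : ρc < ρb) (hρab : ρb < ρa) :
    ∃ Ψ : ℝ≥0 → ℝ≥0∞ → ℝ≥0∞, (∀ K S, S ≠ ⊤ → Ψ K S ≠ ⊤) ∧ (∀ K, Monotone (Ψ K)) ∧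
      ∀ (K : ℝ≥0) (u : ℝ → EuclideanSpace ℝ (Fin 3) → EuclideanSpace ℝ (Fin 3))
        (G : ℝ → EuclideanSpace ℝ (Fin 3) → EuclideanSpace ℝ (Fin 3) →L[ℝ] EuclideanSpace ℝ (Fin 3))
        (U : List (Fin 3) → Fin 3 → ℝ × EuclideanSpace ℝ (Fin 3) → ℝ)
        (A : List (Fin 3) → Fin 3 → Fin 3 → ℝ × EuclideanSpace ℝ (Fin 3) → ℝ),
        BaseHeat u G La ρa → BasePoisson u G La ρa → LevelData u G La ρa k K U A →
        (∀ α : List (Fin 3), α.length ≤ k + 1 → ∀ l,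
          IsRepDeriv (cylOpens La ρa) (fun q => u q.1 q.2 l) (α.map frame) (U α l)) →
        (∀ α : List (Fin 3), α.length ≤ k + 1 → ∀ b c,
          IsRepDeriv (cylOpens La ρa) (spinEntry G b c) (α.map frame) (A α b c)) →
        ∀ δ : List (Fin 3), δ.length = k + 1 →
          (∀ l, MemLp (U δ l) m (volume.restrict (cyl La ρa))) →
          (∀ b c, MemLp (A δ b c) m (volume.restrict (cyl La ρa))) →
          (∀ l, MemLp (U δ l) m' (volume.restrict (cyl Lb ρc))) ∧
          (∀ b c, MemLp (A δ b c) m' (volume.restrict (cyl Lb ρc))) ∧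
          (∑ l, eLpNorm (U δ l) m' (volume.restrict (cyl Lb ρc)) +
              ∑ b, ∑ c, eLpNorm (A δ b c) m' (volume.restrict (cyl Lb ρc))) ≤
            Ψ K (∑ l, eLpNorm (U δ l) m (volume.restrict (cyl La ρa)) +
              ∑ b, ∑ c, eLpNorm (A δ b c) m (volume.restrict (cyl La ρa))) := by
  have hm1 : (1 : ℝ≥0∞) ≤ m := h1m.le
  have hm'1 : (1 : ℝ≥0∞) ≤ m' := hm1.trans hmm'
  have h2m' : (2 : ℝ≥0∞) ≤ m' := h2m.trans hmm'
  have hLa : 0 < La := hLb.trans hLab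
  have hρb : 0 < ρb := hρc.trans hρbc
  have hρa : 0 < ρa := hρb.trans hρab
  -- the constants
  obtain ⟨CF, hCF⟩ := HeatDivForm.heatDivForm_improvement_top_quant h1m hmm' hexp
    (L := La) (L' := Lb) (ρ := ρa) (ρ' := ρb) hLb hLab hρb hρab
  -- the elliptic constant: finite or infinite exponent
  have hE : ∃ CE : ℝ≥0, ∀ (K : ℝ≥0) (v v' : ℝ × EuclideanSpace ℝ (Fin 3) → ℝ)
      (F F' : Fin 3 → ℝ × EuclideanSpace ℝ (Fin 3) → ℝ) (i : Fin 3),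
      AEStronglyMeasurable v (volume.restrict (cyl Lb ρb)) →
      (∀ᵐ q ∂(volume.restrict (cyl Lb ρb)), |v q| ≤ K) →
      (∀ c, AEStronglyMeasurable (F c) (volume.restrict (cyl Lb ρb))) →
      (∀ c, ∀ᵐ q ∂(volume.restrict (cyl Lb ρb)), |F c q| ≤ K) →
      (∀ ψ : ℝ → EuclideanSpace ℝ (Fin 3) → ℝ, IsSpaceTimeTestOn (cylOpens Lb ρb) ψ →
        ∫ q : ℝ × EuclideanSpace ℝ (Fin 3), v q * (Δ (ψ q.1)) q.2 =
          -∑ c, ∫ q : ℝ × EuclideanSpace ℝ (Fin 3), F c q * fderiv ℝ (ψ q.1) q.2 (frame c)) →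
      MemLp v' 2 (volume.restrict (cyl Lb ρb)) →
      (∀ c, MemLp (F' c) m' (volume.restrict (cyl Lb ρb))) →
      (∀ ψ : ℝ → EuclideanSpace ℝ (Fin 3) → ℝ, IsSpaceTimeTestOn (cylOpens Lb ρb) ψ →
        ∫ q : ℝ × EuclideanSpace ℝ (Fin 3), v q * fderiv ℝ (ψ q.1) q.2 (frame i) =
          -∫ q : ℝ × EuclideanSpace ℝ (Fin 3), v' q * ψ q.1 q.2) →
      (∀ ψ : ℝ → EuclideanSpace ℝ (Fin 3) → ℝ, IsSpaceTimeTestOn (cylOpens Lb ρb) ψ →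
        ∫ q : ℝ × EuclideanSpace ℝ (Fin 3), v' q * (Δ (ψ q.1)) q.2 =
          -∑ c, ∫ q : ℝ × EuclideanSpace ℝ (Fin 3), F' c q * fderiv ℝ (ψ q.1) q.2 (frame c)) →
      eLpNorm v' m' (volume.restrict (cyl Lb ρc)) ≤ CE * (K + ∑ c, eLpNorm (F' c) m' (volume.restrict (cyl Lb ρb))) := by
    rcases hm' with h6 | htop
    · obtain ⟨CE, hCE⟩ := eLpNorm_partial_le_of_poisson_pair (m := m') h2m' h6 (L := Lb) hρc hρbc (le_refl ρb)
      exact ⟨CE, fun K v v' F F' i h1 h2 h3 h4 h5 h6' h7 h8 h9 => hCE K v v' F F' i h1 h2 h3 h4 h5 h6' h7 h8 h9⟩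
    · subst htop
      obtain ⟨CE, hCE⟩ := ae_enorm_partial_le_of_poisson_pair (L := Lb) hρc hρbc (le_refl ρb)
      refine ⟨CE, fun K v v' F F' i h1 h2 h3 h4 h5 h6' h7 h8 h9 => ?_⟩
      have h := hCE K v v' F F' i h1 h2 h3 h4 h5 h6' h7 h8 h9
      rw [eLpNorm_exponent_top]
      exact eLpNormEssSup_le_of_ae_enorm_bound h
  obtain ⟨CE, hCE⟩ := hE
  -- volumes and the bound
  set V : ℝ≥0∞ := (volume (cyl La ρa)) ^ m.toReal⁻¹ with hV
  have hVt : V ≠ ⊤ := ENNReal.rpow_ne_top_of_nonneg (by positivity) (volume_cyl_lt_top La ρa).ne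
  set FB : ℝ≥0 → ℝ≥0∞ → ℝ≥0∞ := fun K S => 6 * (3 * 2 ^ k * (2 * K * S + 2 * K * K * V)) with hFB
  set BA : ℝ≥0 → ℝ≥0∞ → ℝ≥0∞ := fun K S => CF * (S + FB K S) with hBA
  set Ψ : ℝ≥0 → ℝ≥0∞ → ℝ≥0∞ := fun K S => 3 * (CE * (K + 3 * BA K S)) + 9 * BA K S with hΨ
  have hFBt : ∀ K S, S ≠ ⊤ → FB K S ≠ ⊤ := fun K S hS =>
    ENNReal.mul_ne_top (by norm_num) (ENNReal.mul_ne_top (ENNReal.mul_ne_top (by norm_num)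
      (ENNReal.pow_ne_top (by norm_num)))
      (ENNReal.add_ne_top.2 ⟨ENNReal.mul_ne_top (ENNReal.mul_ne_top (by norm_num) ENNReal.coe_ne_top) hS,
        ENNReal.mul_ne_top (ENNReal.mul_ne_top (ENNReal.mul_ne_top (by norm_num) ENNReal.coe_ne_top)
          ENNReal.coe_ne_top) hVt⟩))
  have hBAt : ∀ K S, S ≠ ⊤ → BA K S ≠ ⊤ := fun K S hS =>
    ENNReal.mul_ne_top ENNReal.coe_ne_top (ENNReal.add_ne_top.2 ⟨hS, hFBt K S hS⟩)
  have hΨt : ∀ K S, S ≠ ⊤ → Ψ K S ≠ ⊤ := fun K S hS =>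
    ENNReal.add_ne_top.2 ⟨ENNReal.mul_ne_top (by norm_num) (ENNReal.mul_ne_top ENNReal.coe_ne_top
      (ENNReal.add_ne_top.2 ⟨ENNReal.coe_ne_top, ENNReal.mul_ne_top (by norm_num) (hBAt K S hS)⟩)),
      ENNReal.mul_ne_top (by norm_num) (hBAt K S hS)⟩
  have hΨmono : ∀ K, Monotone (Ψ K) := by
    intro K S S' hSS'
    simp only [hΨ, hBA, hFB]
    gcongr
  refine ⟨Ψ, hΨt, hΨmono, ?_⟩
  intro K u G U A hheat hpoi hdata hrepU hrepA δ hδ hUδ hAδ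
  obtain ⟨i, γ, rfl, hγ⟩ := exists_eq_cons_of_length hδ
  haveI := isFiniteMeasure_restrict_cyl La ρa
  haveI := isFiniteMeasure_restrict_cyl Lb ρb
  haveI := isFiniteMeasure_restrict_cyl Lb ρc
  set μa : Measure (ℝ × EuclideanSpace ℝ (Fin 3)) := volume.restrict (cyl La ρa) with hμa
  set μb : Measure (ℝ × EuclideanSpace ℝ (Fin 3)) := volume.restrict (cyl Lb ρb) with hμb
  set μc : Measure (ℝ × EuclideanSpace ℝ (Fin 3)) := volume.restrict (cyl Lb ρc) with hμc
  have hba : cyl Lb ρb ⊆ cyl La ρa := cyl_mono hLab.le hρab.le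
  have hcb : cyl Lb ρc ⊆ cyl Lb ρb := cyl_mono le_rfl hρbc.le
  have hca : cyl Lb ρc ⊆ cyl La ρa := hcb.trans hba
  have hOba : cylOpens Lb ρb ≤ cylOpens La ρa := cylOpens_mono hLab.le hρab.le
  set S : ℝ≥0∞ := ∑ l, eLpNorm (U (i :: γ) l) m μa + ∑ b, ∑ c, eLpNorm (A (i :: γ) b c) m μa with hS
  have hSU : ∀ l, eLpNorm (U (i :: γ) l) m μa ≤ S := fun l =>
    le_add_right (Finset.single_le_sum (f := fun l => eLpNorm (U (i :: γ) l) m μa) (fun _ _ => zero_le) (Finset.mem_univ l))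
  have hSA : ∀ b c, eLpNorm (A (i :: γ) b c) m μa ≤ S := fun b c =>
    le_add_left ((Finset.single_le_sum (f := fun c => eLpNorm (A (i :: γ) b c) m μa) (fun _ _ => zero_le)
      (Finset.mem_univ c)).trans (Finset.single_le_sum (f := fun b => ∑ c, eLpNorm (A (i :: γ) b c) m μa)
      (fun _ _ => zero_le) (Finset.mem_univ b)))
  -- hypotheses of the Leibniz lemmas at order `k + 1`
  have hbdU : ∀ α : List (Fin 3), α.length + 1 ≤ k + 1 → ∀ l,
      ∀ᵐ q ∂(volume : Measure (ℝ × EuclideanSpace ℝ (Fin 3))), q ∈ cyl La ρa → |U α l q| ≤ K :=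
    fun α hα l => hdata.ae_abs_U_le (by omega) l
  have hbdA : ∀ α : List (Fin 3), α.length + 1 ≤ k + 1 → ∀ b c,
      ∀ᵐ q ∂(volume : Measure (ℝ × EuclideanSpace ℝ (Fin 3))), q ∈ cyl La ρa → |A α b c q| ≤ K :=
    fun α hα b c => hdata.ae_abs_A_le (by omega) b c
  have hmeasU : ∀ α : List (Fin 3), α.length ≤ k + 1 → ∀ l, AEStronglyMeasurable (U α l) μa :=
    fun α hα l => (hrepU α hα l).locallyIntegrableOn.aestronglyMeasurable
  have hmeasA : ∀ α : List (Fin 3), α.length ≤ k + 1 → ∀ b c, AEStronglyMeasurable (A α b c) μa :=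
    fun α hα b c => (hrepA α hα b c).locallyIntegrableOn.aestronglyMeasurable
  have hbdU' : ∀ α : List (Fin 3), α.length ≤ k → ∀ l, ∀ᵐ q ∂μa, |U α l q| ≤ K :=
    fun α hα l => (hdata α hα l l).2.2.1
  have hbdA' : ∀ α : List (Fin 3), α.length ≤ k → ∀ b c, ∀ᵐ q ∂μa, |A α b c q| ≤ K :=
    fun α hα b c => (hdata α hα b c).2.2.2
  -- the flux bound at order `k + 1`
  have hprod : ∀ l b l', eLpNorm (prodRep U A (i :: γ) l b l') m μa ≤
      2 ^ k * ((K : ℝ≥0∞) * (eLpNorm (U (i :: γ) l) m μa + eLpNorm (A (i :: γ) b l') m μa) + 2 * (K : ℝ≥0∞) * K * V) :=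
    fun l b l' => eLpNorm_prodRep_cons_le (n := k) hm1 hmeasU hmeasA hbdU' hbdA' hγ i l b l'
  have hsumprod : ∀ b, ∑ l, eLpNorm (prodRep U A (i :: γ) l b l) m μa ≤ 3 * 2 ^ k * (2 * K * S + 2 * K * K * V) := by
    intro b
    calc ∑ l, eLpNorm (prodRep U A (i :: γ) l b l) m μa
        ≤ ∑ l, 2 ^ k * ((K : ℝ≥0∞) * (eLpNorm (U (i :: γ) l) m μa + eLpNorm (A (i :: γ) b l) m μa) +
            2 * (K : ℝ≥0∞) * K * V) := Finset.sum_le_sum fun l _ => hprod l b l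
      _ ≤ ∑ _l : Fin 3, 2 ^ k * ((K : ℝ≥0∞) * (S + S) + 2 * (K : ℝ≥0∞) * K * V) := by
          refine Finset.sum_le_sum fun l _ => ?_
          gcongr
          · exact hSU l
          · exact hSA b l
      _ = 3 * 2 ^ k * (2 * K * S + 2 * K * K * V) := by
          rw [Finset.sum_const, Finset.card_univ, Fintype.card_fin, nsmul_eq_mul]
          push_cast
          ring
  have hin : ∀ j j' : Fin 3, ‖⟪(frame j : EuclideanSpace ℝ (Fin 3)), frame j'⟫‖ ≤ 1 := fun j j' => by
    rw [orthonormal_iff_ite.1 frame.orthonormal]; split_ifs <;> simp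
  have hmeasP : ∀ l b l', AEStronglyMeasurable (prodRep U A (i :: γ) l b l') μa := fun l b l' =>
    aestronglyMeasurable_prodRep (n := k + 1) hmeasU hmeasA hδ.le l b l'
  have hfluxn : ∀ b c i', eLpNorm (fluxRep U A (i :: γ) b c i') m μa ≤ 2 * (3 * 2 ^ k * (2 * K * S + 2 * K * K * V)) := by
    intro b c i'
    have hs1 : AEStronglyMeasurable (fun q => ∑ l, prodRep U A (i :: γ) l b l q) μa :=
      Finset.aestronglyMeasurable_fun_sum _ fun l _ => hmeasP l b l
    have hs2 : AEStronglyMeasurable (fun q => ∑ l, prodRep U A (i :: γ) l c l q) μa :=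
      Finset.aestronglyMeasurable_fun_sum _ fun l _ => hmeasP l c l
    have e1 : eLpNorm (fun q => ∑ l, prodRep U A (i :: γ) l b l q) m μa ≤ 3 * 2 ^ k * (2 * K * S + 2 * K * K * V) := by
      have e : (fun q => ∑ l, prodRep U A (i :: γ) l b l q) = ∑ l, prodRep U A (i :: γ) l b l := by
        funext q; simp [Finset.sum_apply]
      rw [e]
      exact (eLpNorm_sum_le (fun l _ => hmeasP l b l) hm1).trans (hsumprod b)
    have e2 : eLpNorm (fun q => ∑ l, prodRep U A (i :: γ) l c l q) m μa ≤ 3 * 2 ^ k * (2 * K * S + 2 * K * K * V) := by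
      have e : (fun q => ∑ l, prodRep U A (i :: γ) l c l q) = ∑ l, prodRep U A (i :: γ) l c l := by
        funext q; simp [Finset.sum_apply]
      rw [e]
      exact (eLpNorm_sum_le (fun l _ => hmeasP l c l) hm1).trans (hsumprod c)
    have t1 : eLpNorm (fun q => -(⟪(frame c : EuclideanSpace ℝ (Fin 3)), frame i'⟫ * ∑ l, prodRep U A (i :: γ) l b l q)) m μa ≤
        3 * 2 ^ k * (2 * K * S + 2 * K * K * V) := by
      have en : (fun q => -(⟪(frame c : EuclideanSpace ℝ (Fin 3)), frame i'⟫ * ∑ l, prodRep U A (i :: γ) l b l q)) =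
          -(fun q => ⟪(frame c : EuclideanSpace ℝ (Fin 3)), frame i'⟫ * ∑ l, prodRep U A (i :: γ) l b l q) := rfl
      rw [en, eLpNorm_neg]
      have h := eLpNorm_le_mul_eLpNorm_of_ae_le_mul (μ := μa)
        (f := fun q => ⟪(frame c : EuclideanSpace ℝ (Fin 3)), frame i'⟫ * ∑ l, prodRep U A (i :: γ) l b l q)
        (g := fun q => ∑ l, prodRep U A (i :: γ) l b l q) (c := 1) (Eventually.of_forall fun q => by
          rw [norm_mul, one_mul]; exact mul_le_of_le_one_left (norm_nonneg _) (hin c i')) m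
      rw [ENNReal.ofReal_one, one_mul] at h
      exact h.trans e1
    have t2 : eLpNorm (fun q => ⟪(frame b : EuclideanSpace ℝ (Fin 3)), frame i'⟫ * ∑ l, prodRep U A (i :: γ) l c l q) m μa ≤
        3 * 2 ^ k * (2 * K * S + 2 * K * K * V) := by
      have h := eLpNorm_le_mul_eLpNorm_of_ae_le_mul (μ := μa)
        (f := fun q => ⟪(frame b : EuclideanSpace ℝ (Fin 3)), frame i'⟫ * ∑ l, prodRep U A (i :: γ) l c l q)
        (g := fun q => ∑ l, prodRep U A (i :: γ) l c l q) (c := 1) (Eventually.of_forall fun q => by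
          rw [norm_mul, one_mul]; exact mul_le_of_le_one_left (norm_nonneg _) (hin b i')) m
      rw [ENNReal.ofReal_one, one_mul] at h
      exact h.trans e2
    have hm_1 : AEStronglyMeasurable
        (fun q => -(⟪(frame c : EuclideanSpace ℝ (Fin 3)), frame i'⟫ * ∑ l, prodRep U A (i :: γ) l b l q)) μa :=
      (aestronglyMeasurable_const.mul hs1).neg
    have hm_2 : AEStronglyMeasurable
        (fun q => ⟪(frame b : EuclideanSpace ℝ (Fin 3)), frame i'⟫ * ∑ l, prodRep U A (i :: γ) l c l q) μa :=
      aestronglyMeasurable_const.mul hs2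
    have e : fluxRep U A (i :: γ) b c i' = fun q =>
        -(⟪(frame c : EuclideanSpace ℝ (Fin 3)), frame i'⟫ * ∑ l, prodRep U A (i :: γ) l b l q) +
          ⟪(frame b : EuclideanSpace ℝ (Fin 3)), frame i'⟫ * ∑ l, prodRep U A (i :: γ) l c l q := by
      funext q; rfl
    rw [e]
    calc eLpNorm (fun q => -(⟪(frame c : EuclideanSpace ℝ (Fin 3)), frame i'⟫ * ∑ l, prodRep U A (i :: γ) l b l q) +
          ⟪(frame b : EuclideanSpace ℝ (Fin 3)), frame i'⟫ * ∑ l, prodRep U A (i :: γ) l c l q) m μa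
        ≤ _ := eLpNorm_add_le hm_1 hm_2 hm1
      _ ≤ 3 * 2 ^ k * (2 * K * S + 2 * K * K * V) + 3 * 2 ^ k * (2 * K * S + 2 * K * K * V) := add_le_add t1 t2
      _ = 2 * (3 * 2 ^ k * (2 * K * S + 2 * K * K * V)) := by ring
  have hfluxm : ∀ b c i', AEStronglyMeasurable (fluxRep U A (i :: γ) b c i') μa := fun b c i' =>
    aestronglyMeasurable_fluxRep (n := k + 1) hmeasU hmeasA hδ.le b c i'
  have hSt : S ≠ ⊤ := by
    refine ENNReal.add_ne_top.2 ⟨(ENNReal.sum_lt_top.2 fun l _ => (hUδ l).eLpNorm_lt_top).ne,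
      (ENNReal.sum_lt_top.2 fun b _ => ENNReal.sum_lt_top.2 fun c _ => (hAδ b c).eLpNorm_lt_top).ne⟩
  have hfluxMem : ∀ b c i', MemLp (fluxRep U A (i :: γ) b c i') m μa := by
    intro b c i'
    refine ⟨hfluxm b c i', lt_of_le_of_lt (hfluxn b c i') ?_⟩
    have := hFBt K S hSt
    simp only [hFB] at this
    refine lt_of_le_of_lt ?_ (lt_top_iff_ne_top.2 this)
    calc 2 * (3 * 2 ^ k * (2 * (K : ℝ≥0∞) * S + 2 * K * K * V)) ≤ 6 * (3 * 2 ^ k * (2 * (K : ℝ≥0∞) * S + 2 * K * K * V)) := by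
          gcongr; norm_num
      _ = _ := rfl
  ---------------------------------------------------------------------------------------------
  -- the parabolic improvement for `A δ b c`
  ---------------------------------------------------------------------------------------------
  have hAstep : ∀ b c, MemLp (A (i :: γ) b c) m' μb ∧ eLpNorm (A (i :: γ) b c) m' μb ≤ BA K S := by
    intro b c
    set gv : ℝ × EuclideanSpace ℝ (Fin 3) → EuclideanSpace ℝ (Fin 3) :=
      fun q => ∑ i', fluxRep U A (i :: γ) b c i' q • (frame i' : EuclideanSpace ℝ (Fin 3)) with hgv
    obtain ⟨hgvm, hgvn⟩ := memLp_sumFrame (μ := μa) hm1 fun i' => hfluxMem b c i'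
    have heq : ∀ ψ : ℝ → EuclideanSpace ℝ (Fin 3) → ℝ, IsSpaceTimeTestOn (cylOpens La ρa) ψ →
        ∫ q : ℝ × EuclideanSpace ℝ (Fin 3), A (i :: γ) b c q * (timeDeriv ψ q.1 q.2 + (Δ (ψ q.1)) q.2) =
          ∫ q : ℝ × EuclideanSpace ℝ (Fin 3), ⟪gv q, gradient (ψ q.1) q.2⟫ := by
      intro ψ hψ
      rw [heat_identity_level (n := k + 1) hheat hrepU hrepA hbdU hbdA hdata.hbase hdata.hflux hδ.le b c hψ]
      have hint : ∀ i', Integrable (fun q : ℝ × EuclideanSpace ℝ (Fin 3) =>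
          fluxRep U A (i :: γ) b c i' q * fderiv ℝ (ψ q.1) q.2 (frame i')) volume := fun i' =>
        (isRepDeriv_fluxRep (Q := cylOpens La ρa) hrepU hrepA hbdU hbdA hdata.hbase hδ.le b c i').2.1
          |> isRepDeriv_nil |>.integrable_mul' (NSSpinHeat.isSpaceTimeTestOn_fderiv_apply hψ (frame i'))
      rw [← integral_finsetSum _ fun i' _ => hint i']
      refine integral_congr_ae (Eventually.of_forall fun q => ?_)
      dsimp only
      rw [hgv, inner_sumFrame_gradient]
    obtain ⟨hmem, hnorm⟩ := hCF (A (i :: γ) b c) gv (hAδ b c) hgvm heq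
    refine ⟨hmem, hnorm.trans ?_⟩
    simp only [hBA]
    refine mul_le_mul' le_rfl (add_le_add (hSA b c) (hgvn.trans ?_))
    calc ∑ i', eLpNorm (fluxRep U A (i :: γ) b c i') m μa ≤ ∑ _i' : Fin 3, 2 * (3 * 2 ^ k * (2 * K * S + 2 * K * K * V)) :=
          Finset.sum_le_sum fun i' _ => hfluxn b c i'
      _ = FB K S := by
          rw [Finset.sum_const, Finset.card_univ, Fintype.card_fin, nsmul_eq_mul, hFB]
          push_cast
          ring
  ---------------------------------------------------------------------------------------------
  -- the elliptic slice step for `U δ b`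
  ---------------------------------------------------------------------------------------------
  have hUstep : ∀ b, eLpNorm (U (i :: γ) b) m' μc ≤ CE * (K + 3 * BA K S) := by
    intro b
    have hγ' : γ.length ≤ k := hγ.le
    -- level-`γ` data on `C(Lb, ρb)`
    have hv : AEStronglyMeasurable (U γ b) μb := (hdata.aesm_U hγ' b).mono_measure (Measure.restrict_mono hba le_rfl)
    have hvb : ∀ᵐ q ∂μb, |U γ b q| ≤ K := ae_restrict_of_ae_restrict_of_subset hba (hdata γ hγ' b b).2.2.1
    have hF : ∀ c, AEStronglyMeasurable (A γ b c) μb := fun c =>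
      (hdata.aesm_A hγ' b c).mono_measure (Measure.restrict_mono hba le_rfl)
    have hFb : ∀ c, ∀ᵐ q ∂μb, |A γ b c q| ≤ K := fun c =>
      ae_restrict_of_ae_restrict_of_subset hba (hdata γ hγ' b c).2.2.2
    have hrepUb : ∀ α : List (Fin 3), α.length ≤ k + 1 → ∀ l,
        IsRepDeriv (cylOpens Lb ρb) (fun q => u q.1 q.2 l) (α.map frame) (U α l) := fun α hα l => (hrepU α hα l).mono hOba
    have hrepAb : ∀ α : List (Fin 3), α.length ≤ k + 1 → ∀ b c,
        IsRepDeriv (cylOpens Lb ρb) (spinEntry G b c) (α.map frame) (A α b c) := fun α hα b c => (hrepA α hα b c).mono hOba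
    have hpoib : BasePoisson u G Lb ρb := hpoi.mono hLab.le hρab.le
    have hidγ := fun ψ (hψ : IsSpaceTimeTestOn (cylOpens Lb ρb) ψ) =>
      poisson_identity_level (n := k + 1) hpoib hrepUb hrepAb (by omega : γ.length ≤ k + 1) b hψ
    have hidδ := fun ψ (hψ : IsSpaceTimeTestOn (cylOpens Lb ρb) ψ) =>
      poisson_identity_level (n := k + 1) hpoib hrepUb hrepAb hδ.le b hψ
    have hfo := fun ψ (hψ : IsSpaceTimeTestOn (cylOpens Lb ρb) ψ) => firstOrder_level (n := k) hrepUb hγ' i b hψ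
    -- level-`δ` data on `C(Lb, ρb)`
    have hv' : MemLp (U (i :: γ) b) 2 μb :=
      ((hUδ b).mono_measure (Measure.restrict_mono hba le_rfl)).mono_exponent h2m
    have hF' : ∀ c, MemLp (A (i :: γ) b c) m' μb := fun c => (hAstep b c).1
    refine (hCE K (U γ b) (U (i :: γ) b) (fun c => A γ b c) (fun c => A (i :: γ) b c) i hv hvb hF hFb hidγ hv' hF'
      hfo hidδ).trans ?_
    refine mul_le_mul' le_rfl (add_le_add le_rfl ?_)
    calc ∑ c, eLpNorm (A (i :: γ) b c) m' μb ≤ ∑ _c : Fin 3, BA K S := Finset.sum_le_sum fun c _ => (hAstep b c).2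
      _ = 3 * BA K S := by rw [Finset.sum_const, Finset.card_univ, Fintype.card_fin, nsmul_eq_mul]; push_cast; ring
  ---------------------------------------------------------------------------------------------
  -- conclusion on `C(Lb, ρc)`
  ---------------------------------------------------------------------------------------------
  have hAc : ∀ b c, MemLp (A (i :: γ) b c) m' μc ∧ eLpNorm (A (i :: γ) b c) m' μc ≤ BA K S := fun b c =>
    ⟨(hAstep b c).1.mono_measure (Measure.restrict_mono hcb le_rfl),
      (eLpNorm_mono_measure _ (Measure.restrict_mono hcb le_rfl)).trans (hAstep b c).2⟩
  have hBASt : BA K S ≠ ⊤ := hBAt K S hSt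
  have hUc : ∀ l, MemLp (U (i :: γ) l) m' μc := fun l =>
    ⟨(hmeasU (i :: γ) hδ.le l).mono_measure (Measure.restrict_mono hca le_rfl),
      lt_of_le_of_lt (hUstep l) (lt_top_iff_ne_top.2 (ENNReal.mul_ne_top ENNReal.coe_ne_top
        (ENNReal.add_ne_top.2 ⟨ENNReal.coe_ne_top, ENNReal.mul_ne_top (by norm_num) hBASt⟩)))⟩
  refine ⟨hUc, fun b c => (hAc b c).1, ?_⟩
  simp only [hΨ]
  refine add_le_add ?_ ?_
  · calc ∑ l, eLpNorm (U (i :: γ) l) m' μc ≤ ∑ _l : Fin 3, (CE : ℝ≥0∞) * (K + 3 * BA K S) :=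
          Finset.sum_le_sum fun l _ => hUstep l
      _ = 3 * ((CE : ℝ≥0∞) * (K + 3 * BA K S)) := by
          rw [Finset.sum_const, Finset.card_univ, Fintype.card_fin, nsmul_eq_mul]; push_cast; ring
  · calc ∑ b, ∑ c, eLpNorm (A (i :: γ) b c) m' μc ≤ ∑ _b : Fin 3, ∑ _c : Fin 3, BA K S :=
          Finset.sum_le_sum fun b _ => Finset.sum_le_sum fun c _ => (hAc b c).2
      _ = 9 * BA K S := by
          simp only [Finset.sum_const, Finset.card_univ, Fintype.card_fin, nsmul_eq_mul]; push_cast; ring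

end Round


/-! ### The level step -/

section Step

/-- Level data are unchanged when the families are replaced by families agreeing at the orders
concerned. [folklore] -/
theorem LevelData.congr_old {L ρ : ℝ} {k : ℕ} {K : ℝ≥0}
    {U' : List (Fin 3) → Fin 3 → ℝ × EuclideanSpace ℝ (Fin 3) → ℝ}
    {A' : List (Fin 3) → Fin 3 → Fin 3 → ℝ × EuclideanSpace ℝ (Fin 3) → ℝ}
    (h : LevelData u G L ρ k K U A) (hold : ∀ α : List (Fin 3), α.length ≤ k → U' α = U α ∧ A' α = A α) :
    LevelData u G L ρ k K U' A' := by
  intro α hα b c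
  rw [(hold α hα).1, (hold α hα).2]
  exact h α hα b c

/-- From an `L^∞` bound of the size to a.e. bounds of the members. [folklore] -/
theorem ae_abs_le_of_eLpNorm_top_le {μ : Measure (ℝ × EuclideanSpace ℝ (Fin 3))} {f : ℝ × EuclideanSpace ℝ (Fin 3) → ℝ}
    {T : ℝ≥0∞} (hT : T ≠ ⊤) (h : eLpNorm f ⊤ μ ≤ T) : ∀ᵐ q ∂μ, |f q| ≤ T.toReal := by
  filter_upwards [ae_le_eLpNormEssSup (f := f) (μ := μ)] with q hq
  have h1 : ‖f q‖ₑ ≤ T := hq.trans (le_trans (le_of_eq (eLpNorm_exponent_top (f := f)).symm) h)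
  rw [← Real.norm_eq_abs, ← toReal_enorm]
  exact (ENNReal.toReal_le_toReal enorm_ne_top hT).2 h1

set_option maxHeartbeats 3200000 in
/-- **The level step of the bootstrap** (Lemarié-Rieusset 2016, Thm. 13.1, Steps 2–3, with the
constants tracked; Seregin–Šverák 2009, §2 p. 8: "Proof of this statements can be done by
induction"). For `0 < L' < L`, `0 < ρ' < ρ` there is `Φ : ℝ≥0 → ℝ≥0` such that the base identities
and level-`k` data bounded by `K` on `C(L, ρ)` yield level-`(k+1)` data bounded by `Φ(K)` on
`C(L', ρ')`, extending the given families. [cite: LemarieRieusset2016, Thm. 13.1, Steps 2–3] -/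
theorem level_step (k : ℕ) {L L' ρ ρ' : ℝ} (hL' : 0 < L') (hLL' : L' < L) (hρ' : 0 < ρ') (hρρ' : ρ' < ρ) :
    ∃ Φ : ℝ≥0 → ℝ≥0, ∀ (K : ℝ≥0) (u : ℝ → EuclideanSpace ℝ (Fin 3) → EuclideanSpace ℝ (Fin 3))
      (G : ℝ → EuclideanSpace ℝ (Fin 3) → EuclideanSpace ℝ (Fin 3) →L[ℝ] EuclideanSpace ℝ (Fin 3))
      (U : List (Fin 3) → Fin 3 → ℝ × EuclideanSpace ℝ (Fin 3) → ℝ)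
      (A : List (Fin 3) → Fin 3 → Fin 3 → ℝ × EuclideanSpace ℝ (Fin 3) → ℝ),
      BaseHeat u G L ρ → BasePoisson u G L ρ → LevelData u G L ρ k K U A →
      ∃ (U' : List (Fin 3) → Fin 3 → ℝ × EuclideanSpace ℝ (Fin 3) → ℝ)
        (A' : List (Fin 3) → Fin 3 → Fin 3 → ℝ × EuclideanSpace ℝ (Fin 3) → ℝ),
        (∀ α : List (Fin 3), α.length ≤ k → U' α = U α ∧ A' α = A α) ∧
        LevelData u G L' ρ' (k + 1) (Φ K) U' A' := by
  -- the schedule: `L = L₀ > L₁ > … > L₄ = L'`, `ρ = ρ₀ > ρ₁ > … > ρ₇ = ρ'`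
  set d : ℝ := (L - L') / 4 with hd
  set e : ℝ := (ρ - ρ') / 7 with he
  have hd0 : 0 < d := by rw [hd]; linarith
  have he0 : 0 < e := by rw [he]; linarith
  set L₁ := L - d; set L₂ := L - 2 * d; set L₃ := L - 3 * d
  set ρ₁ := ρ - e; set ρ₂ := ρ - 2 * e; set ρ₃ := ρ - 3 * e; set ρ₄ := ρ - 4 * e; set ρ₅ := ρ - 5 * e; set ρ₆ := ρ - 6 * e
  have hL4 : L - 4 * d = L' := by rw [hd]; ring
  have hρ7 : ρ - 7 * e = ρ' := by rw [he]; ring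
  obtain ⟨e23, e36, e6t⟩ := improvement_exponents
  obtain ⟨Φ₂, hΦ₂t, hnew⟩ := exists_new_reps k (L := L) (L₁ := L₁) (ρ := ρ) (ρ₁ := ρ₁)
    (by linarith) (by linarith) (by linarith) (by linarith)
  obtain ⟨Ψ₁, hΨ₁t, hΨ₁m, hround₁⟩ := round k (m := 2) (m' := 3) (by norm_num) le_rfl (by norm_num) e23
    (Or.inl (by norm_num)) (La := L₁) (Lb := L₂) (ρa := ρ₁) (ρb := ρ₂) (ρc := ρ₃)
    (by linarith) (by linarith) (by linarith) (by linarith) (by linarith)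
  obtain ⟨Ψ₂, hΨ₂t, hΨ₂m, hround₂⟩ := round k (m := 3) (m' := 6) (by norm_num) (by norm_num) (by norm_num) e36
    (Or.inl le_rfl) (La := L₂) (Lb := L₃) (ρa := ρ₃) (ρb := ρ₄) (ρc := ρ₅)
    (by linarith) (by linarith) (by linarith) (by linarith) (by linarith)
  obtain ⟨Ψ₃, hΨ₃t, hΨ₃m, hround₃⟩ := round k (m := 6) (m' := ⊤) (by norm_num) (by norm_num) le_top e6t
    (Or.inr rfl) (La := L₃) (Lb := L') (ρa := ρ₅) (ρb := ρ₆) (ρc := ρ')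
    hL' (by linarith) hρ' (by linarith) (by linarith)
  set T : ℝ≥0 → ℝ≥0∞ := fun K => Ψ₃ K (Ψ₂ K (Ψ₁ K (Φ₂ K))) with hT
  have hTt : ∀ K, T K ≠ ⊤ := fun K => hΨ₃t K _ (hΨ₂t K _ (hΨ₁t K _ (hΦ₂t K)))
  refine ⟨fun K => max K (T K).toNNReal, ?_⟩
  intro K u G U A hheat hpoi hdata
  obtain ⟨U', A', hold, hrepU', hrepA', hL2⟩ := hnew K u G U A hheat hpoi hdata
  -- level-`k` data of the extended families on the smaller cylinders
  have hdata₁ : LevelData u G L₁ ρ₁ k K U' A' := (hdata.mono (by linarith) (by linarith) le_rfl le_rfl).congr_old hold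
  have hdata₂ : LevelData u G L₂ ρ₃ k K U' A' := hdata₁.mono (by linarith) (by linarith) le_rfl le_rfl
  have hdata₃ : LevelData u G L₃ ρ₅ k K U' A' := hdata₁.mono (by linarith) (by linarith) le_rfl le_rfl
  have hrepU₂ : ∀ α : List (Fin 3), α.length ≤ k + 1 → ∀ l,
      IsRepDeriv (cylOpens L₂ ρ₃) (fun q => u q.1 q.2 l) (α.map frame) (U' α l) :=
    fun α hα l => (hrepU' α hα l).mono (cylOpens_mono (by linarith) (by linarith))
  have hrepA₂ : ∀ α : List (Fin 3), α.length ≤ k + 1 → ∀ b c,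
      IsRepDeriv (cylOpens L₂ ρ₃) (spinEntry G b c) (α.map frame) (A' α b c) :=
    fun α hα b c => (hrepA' α hα b c).mono (cylOpens_mono (by linarith) (by linarith))
  have hrepU₃ : ∀ α : List (Fin 3), α.length ≤ k + 1 → ∀ l,
      IsRepDeriv (cylOpens L₃ ρ₅) (fun q => u q.1 q.2 l) (α.map frame) (U' α l) :=
    fun α hα l => (hrepU' α hα l).mono (cylOpens_mono (by linarith) (by linarith))
  have hrepA₃ : ∀ α : List (Fin 3), α.length ≤ k + 1 → ∀ b c,
      IsRepDeriv (cylOpens L₃ ρ₅) (spinEntry G b c) (α.map frame) (A' α b c) :=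
    fun α hα b c => (hrepA' α hα b c).mono (cylOpens_mono (by linarith) (by linarith))
  -- the three rounds for every new multi-index
  have hfinal : ∀ δ : List (Fin 3), δ.length = k + 1 →
      (∑ l, eLpNorm (U' δ l) ⊤ (volume.restrict (cyl L' ρ')) +
        ∑ b, ∑ c, eLpNorm (A' δ b c) ⊤ (volume.restrict (cyl L' ρ'))) ≤ T K := by
    intro δ hδ
    obtain ⟨hU2, hA2, hS2⟩ := hL2 δ hδ
    obtain ⟨hU3, hA3, hS3⟩ := hround₁ K u G U' A' (hheat.mono (by linarith) (by linarith))
      (hpoi.mono (by linarith) (by linarith)) hdata₁ hrepU' hrepA' δ hδ hU2 hA2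
    obtain ⟨hU6, hA6, hS6⟩ := hround₂ K u G U' A' (hheat.mono (by linarith) (by linarith))
      (hpoi.mono (by linarith) (by linarith)) hdata₂ hrepU₂ hrepA₂ δ hδ hU3 hA3
    obtain ⟨-, -, hSt⟩ := hround₃ K u G U' A' (hheat.mono (by linarith) (by linarith))
      (hpoi.mono (by linarith) (by linarith)) hdata₃ hrepU₃ hrepA₃ δ hδ hU6 hA6
    refine hSt.trans ?_
    simp only [hT]
    exact hΨ₃m K ((hS6.trans (hΨ₂m K (hS3.trans (hΨ₁m K hS2)))))
  refine ⟨U', A', hold, ?_⟩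
  -- packaging
  have hKΦ : (K : ℝ) ≤ ((max K (T K).toNNReal : ℝ≥0) : ℝ) := by exact_mod_cast le_max_left _ _
  have hTΦ : (T K).toReal ≤ ((max K (T K).toNNReal : ℝ≥0) : ℝ) := by
    have : ((T K).toNNReal : ℝ) = (T K).toReal := rfl
    rw [← this]; exact_mod_cast le_max_right _ _
  intro α hα b c
  rcases Nat.lt_or_ge α.length (k + 1) with hlt | hge
  · have h := (hdata₁.mono (show L' ≤ L₁ by linarith) (show ρ' ≤ ρ₁ by linarith) le_rfl
      (le_max_left K (T K).toNNReal)) α (by omega) b c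
    exact h
  · have hαk : α.length = k + 1 := by omega
    have hTT := hfinal α hαk
    set μ' : Measure (ℝ × EuclideanSpace ℝ (Fin 3)) := volume.restrict (cyl L' ρ') with hμ'
    have hUle : eLpNorm (U' α b) ⊤ μ' ≤ T K :=
      (le_add_right (Finset.single_le_sum (f := fun l => eLpNorm (U' α l) ⊤ μ') (fun _ _ => zero_le) (Finset.mem_univ b))).trans hTT
    have hAle : eLpNorm (A' α b c) ⊤ μ' ≤ T K :=
      (le_add_left ((Finset.single_le_sum (f := fun c => eLpNorm (A' α b c) ⊤ μ') (fun _ _ => zero_le)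
        (Finset.mem_univ c)).trans (Finset.single_le_sum (f := fun b => ∑ c, eLpNorm (A' α b c) ⊤ μ')
        (fun _ _ => zero_le) (Finset.mem_univ b)))).trans hTT
    refine ⟨(hrepU' α hα b).mono (cylOpens_mono (by linarith) (by linarith)),
      (hrepA' α hα b c).mono (cylOpens_mono (by linarith) (by linarith)), ?_, ?_⟩
    · exact (ae_abs_le_of_eLpNorm_top_le (hTt K) hUle).mono fun q hq => hq.trans hTΦ
    · exact (ae_abs_le_of_eLpNorm_top_le (hTt K) hAle).mono fun q hq => hq.trans hTΦ

end Step

end NSBootstrap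

end Literature.Analysis.FluidPDE

end
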